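import Summits.BirchSwinnertonDyer.BirchSwinnertonDyer.Theorems.PrintCf2SplitBadTwoRestrictedSelmerCokernelOfLocSurjFrame
import HarnessLib

/-!
# Crux `PrintCf2.SplitBadTwoRankOneOfFacts` (stmt-BirchSwinnertonDyer-20368), road α v10.3 — S3c residual (R-SURJ), file 4c:
# cut 8's (R-SURJ″) from (LS) GRANTED ONLY UNDER THE BOTTOM FINITENESS `𝔖_{v̄}(K, W*)` finite — which (R-SURJ″)'s own binder `𝔖^Γ` finite supplies

Cell `bsd-print-cf2`, width seat `bsd-line-cf2-p1-w5` g3 (prover-bsd-line-cf2-p1-w5-g3-0); lane «(R-SURJ)». `--supports stmt-BirchSwinnertonDyer-20368`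
(helper, Theses-free). HONEST FRAMING: nothing here closes the crux or a registered stub; BSD is not proved by any of this; no summit statement is proved
by this seat. No definition, no named fact, no `sorry`. CONDITIONAL on the displayed hypothesis (LS)-under-finiteness, nothing else.

WHY. File 4b (p670812) derived cut 7/8's displayed (R-SURJ″) from `hLSall` = (LS) on EVERY frame, unconditionally. The (LS) port in progress (-w4 g9
p670877 `sum_localTatePairingZMod_liftFamily_eq_zero_of_proj`, file 6a `levelLiftingP_of_proj`; -w3 g9 p670630; -w2 g10 conjugation transport) proves
(LS) per frame UNDER bottom finiteness hypotheses (`hfinB′`-currency: `𝔖_v(K, W*′)` finite, transported from `𝔖_{v̄}(K, W*)` finite). (R-SURJ″)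
quantifies over frames carrying `Finite 𝔖^Γ` (`𝔖^Γ = endInvariants (conjRestricted κ' W* v̄ γ' − 1)`), and since the kernel of control is `⊥`
UNCONDITIONALLY (-w6 g2 `ker_control_of_frame_eq_bot_unconditional`), `𝔖_{v̄}(K, W*) ↪ 𝔖^Γ`: **`Finite 𝔖^Γ ⟹ Finite 𝔖_{v̄}(K, W*)`**. So the
weaker displayed hypothesis «∀ frames, `Finite 𝔖_{v̄}(K, W*)` → (LS)» already gives (R-SURJ″):
* `finite_restrictedSelmerBase_of_finite_endInvariants` (generic `K, κ, M, 𝔮, γ`): `𝔖_𝔮(K, M) ⊓ ker res = ⊥` and `𝔖^Γ` finite ⟹ `𝔖_𝔮(K, M)` finite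
  (the injection `c ↦ res c`);
* `finite_restrictedSelmerBase_of_frame_of_finite_endInvariants` (every S3c frame, no hypothesis beyond the frame);
* **`rSurj''_of_locSurj_of_finite`**: cut 7/8's `hSurj` VERBATIM (p668543 = p670076) with `es ≡ −1` from
  `hLSfin : ∀ frames, Finite (restrictedSelmerBase W* 2 vbar) → (LS)`.
presearch: not applicable (bookkeeping). beyond-print theorem: no.

References: [Agboola2007] §3 Prop. 3.2, §6; [GreenbergLNM1716] §3 Lemmas 3.1–3.3; [JetchevSkinnerWan2017] Lemma 3.3.3, Prop. 3.3.2.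
-/

noncomputable section

open scoped Classical

set_option linter.dupNamespace false
set_option autoImplicit false

open NumberField IsDedekindDomain Field
open Literature.NumberTheory.EllipticCurves Literature.NumberTheory.EllipticCurves.GreenbergSelmer
open Literature.NumberTheory.EllipticCurves.Agboola2007
open Literature.NumberTheory.EllipticCurves.IwasawaDual
open Literature.NumberTheory.EllipticCurves.ResKernel
open Literature.NumberTheory.GaloisRepresentations

universe u

namespace Summit.BirchSwinnertonDyer.BirchSwinnertonDyer.Theorems.PrintCf2.RestrictedSelmerPair

/-! ## §1. Generic: `𝔖^Γ` finite and trivial control kernel ⟹ `𝔖_𝔮(K, M)` finite -/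

section Generic

variable {K : Type u} [Field K] [NumberField K] {p : ℕ} [Fact p.Prime] (κ : ZpExtension K p)
  (M : Type u) [AddCommGroup M] [DistribMulAction (absoluteGaloisGroup K) M]
  [TopologicalSpace M] [DiscreteTopology M] (𝔮 : HeightOneSpectrum (𝓞 K))

/-- **`𝔖^Γ` finite and `𝔖_𝔮(K, M) ⊓ ker res = ⊥` ⟹ `𝔖_𝔮(K, M)` finite**: `c ↦ res c` injects `𝔖_𝔮(K, M)` into
`𝔖^Γ = ker(conj_γ − 1 | 𝔖_𝔮(K_∞, M))` (restriction carries `𝔖_𝔮(K, M)` into `𝔖_𝔮(K_∞, M)`, `resOfLe_mem_restrictedSelmer`, and conjugation by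
`γ ∈ ⊤` fixes restricted classes, `conjH1_resOfLe_of_mem`). [cite: Agboola2007, §3 Prop. 3.2 (arXiv p0008:L128–135)] [cite: GreenbergLNM1716, §3 Lemma 3.1] -/
theorem finite_restrictedSelmerBase_of_finite_endInvariants (γ : absoluteGaloisGroup K)
    [hE : Finite (endInvariants (conjRestricted κ M 𝔮 γ - 1))]
    (hker : restrictedSelmerBase M p 𝔮 ⊓ (resOfLe M (le_top : κ.kerSubgroup ≤ ⊤)).ker = ⊥) :
    Finite (restrictedSelmerBase M p 𝔮) := by
  set H := κ.kerSubgroup with hHdef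
  set f : subgroupH1 (⊤ : Subgroup (absoluteGaloisGroup K)) M →+ subgroupH1 H M := resOfLe M (le_top : H ≤ ⊤) with hfdef
  set S := restrictedSelmerZp κ M 𝔮 with hSdef
  set E : AddSubgroup S := endInvariants (conjRestricted κ M 𝔮 γ - 1) with hEdef
  set SK := restrictedSelmerBase M p 𝔮 with hSKdef
  have hS : ∀ c : SK, f c ∈ S := fun c ↦ resOfLe_mem_restrictedSelmer M p 𝔮 le_top c.2
  have hEm : ∀ c : SK, (⟨f c, hS c⟩ : S) ∈ E := fun c ↦ by
    rw [hEdef, mem_endInvariants_conjRestricted_iff]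
    exact conjH1_resOfLe_of_mem M (le_top : H ≤ ⊤) (Subgroup.mem_top γ) (c : subgroupH1 ⊤ M)
  let j : SK → E := fun c ↦ ⟨⟨f c, hS c⟩, hEm c⟩
  refine Finite.of_injective j fun a b hab ↦ ?_
  have h1 : f a = f b := congrArg (fun e : E ↦ ((e : S) : subgroupH1 H M)) hab
  have hmem : ((a : subgroupH1 (⊤ : Subgroup (absoluteGaloisGroup K)) M) - (b : subgroupH1 (⊤ : Subgroup (absoluteGaloisGroup K)) M))
      ∈ SK ⊓ f.ker :=
    AddSubgroup.mem_inf.mpr ⟨SK.sub_mem a.2 b.2, (AddMonoidHom.mem_ker).mpr (by rw [map_sub, h1, sub_self])⟩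
  rw [hker, AddSubgroup.mem_bot, sub_eq_zero] at hmem
  exact Subtype.ext hmem

end Generic

/-! ## §2. Road α: `𝔖^Γ` finite ⟹ `𝔖_{v̄}(K, W*)` finite on every frame; (R-SURJ″) from (LS)-under-finiteness -/

section Frame

open WeierstrassCurve
open Summit.BirchSwinnertonDyer.BirchSwinnertonDyer.Theorems.PrintCf2.AdditiveAtSeven
open Summit.BirchSwinnertonDyer.BirchSwinnertonDyer.Theorems.GoldfeldGoodTwists

variable {K : Type} [Field K] [NumberField K]

/-- **On every S3c frame `𝔖^Γ` finite ⟹ `𝔖_{v̄}(K, W*)` finite** (the control kernel is `⊥` unconditionally, -w6 g2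
`ker_control_of_frame_eq_bot_unconditional`). [cite: Agboola2007, §3 Prop. 3.2] [cite: GreenbergLNM1716, §3 Lemmas 3.1 and 3.3] -/
theorem finite_restrictedSelmerBase_of_frame_of_finite_endInvariants {d : ℤ} (hd0 : d ≠ 0)
    (W : WeierstrassCurve ℚ) [W.IsElliptic] (C : VariableChange ℚ) (hC : C • W = cm7.quadraticTwist (d : ℚ))
    (hK : IsImaginaryQuadratic K) {v vbar : HeightOneSpectrum (𝓞 K)} (hv : ((2 : ℕ) : 𝓞 K) ∈ v.asIdeal)
    (hvbar : ((2 : ℕ) : 𝓞 K) ∈ vbar.asIdeal) (hne : vbar ≠ v) (π : (W.baseChange K).endRing)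
    (hrel : (π : AddMonoid.End (W.baseChange K).geomPoints) * π = π - 2) {r : ℤ_[2]} (hr : r * r = r - 2)
    (κ' : ZpExtension K 2) (hκ' : κ'.IsUnramifiedOutside vbar) (γ' : absoluteGaloisGroup K)
    [Finite (endInvariants (conjRestricted κ' ↥((W.baseChange K).endEigenPrimaryTorsion 2 π r) vbar γ' - 1))] :
    Finite (restrictedSelmerBase ↥((W.baseChange K).endEigenPrimaryTorsion 2 π r) 2 vbar) :=
  finite_restrictedSelmerBase_of_finite_endInvariants κ' ↥((W.baseChange K).endEigenPrimaryTorsion 2 π r) vbar γ'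
    (ker_control_of_frame_eq_bot_unconditional hd0 W C hC hK v vbar hv hvbar hne π hrel hr κ' hκ')

/-- **CUT 7/8's (R-SURJ″) (`hSurj` of p668543 = p670076) VERBATIM, `es ≡ −1`, FROM (LS) GRANTED ONLY UNDER `𝔖_{v̄}(K, W*)` FINITE** — the
finiteness is supplied by (R-SURJ″)'s own binder `Finite 𝔖^Γ` (§2). `hLSfin` is the shape in which the (LS) port delivers (bottom finiteness in,
surjectivity out). [cite: Agboola2007, §3 Prop. 3.2, §6] [cite: GreenbergLNM1716, §3 Lemmas 3.1–3.3] [cite: JetchevSkinnerWan2017, Lemma 3.3.3, Prop. 3.3.2] -/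
theorem rSurj''_of_locSurj_of_finite
    (hLSfin : ∀ (d : ℤ), d ≠ 0 → Squarefree d → d % 4 ≠ 1 →
      ∀ (W : WeierstrassCurve ℚ) [W.IsElliptic] (C : VariableChange ℚ), C • W = cm7.quadraticTwist (d : ℚ) →
      ∀ (K : Type) [Field K] [NumberField K], IsImaginaryQuadratic K →
      ∀ (v vbar : HeightOneSpectrum (𝓞 K)),
        ((2 : ℕ) : 𝓞 K) ∈ v.asIdeal → ((2 : ℕ) : 𝓞 K) ∈ vbar.asIdeal → vbar ≠ v →
      ∀ (π : (W.baseChange K).endRing), (π : AddMonoid.End (W.baseChange K).geomPoints) * π = π - 2 →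
      ∀ (r : ℤ_[2]), r * r = r - 2 →
      Finite (restrictedSelmerBase ↥((W.baseChange K).endEigenPrimaryTorsion 2 π r) 2 vbar) →
      ∀ (S : Finset (HeightOneSpectrum (𝓞 K))), (∀ w ∈ S, ((2 : ℕ) : 𝓞 K) ∉ w.asIdeal ∨ w = vbar) →
      ∀ τ : (w : HeightOneSpectrum (𝓞 K)) → subgroupH1 (decomp (K := K) w) ↥((W.baseChange K).endEigenPrimaryTorsion 2 π r),
      ∃ g : discreteH1 (absoluteGaloisGroup K) ↥((W.baseChange K).endEigenPrimaryTorsion 2 π r),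
        (∀ w ∈ S, ResKernel.resSubgroup (decomp (K := K) w) ↥((W.baseChange K).endEigenPrimaryTorsion 2 π r) g = τ w) ∧
        (∀ w : HeightOneSpectrum (𝓞 K), w ∉ S → ((2 : ℕ) : 𝓞 K) ∉ w.asIdeal →
          ResKernel.resSubgroup (decomp (K := K) w) ↥((W.baseChange K).endEigenPrimaryTorsion 2 π r) g = 0)) :
    ∃ es : ℤ → ℤ → ℤ, ∀ (d : ℤ), d ≠ 0 → Squarefree d → d % 4 ≠ 1 →
      ∀ (W : WeierstrassCurve ℚ) [W.IsElliptic] [W.IsGloballyMinimal] (C : VariableChange ℚ),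
        C • W = cm7.quadraticTwist (d : ℚ) → W.analyticRank = 1 →
      ∀ (K : Type) [Field K] [NumberField K], IsImaginaryQuadratic K →
      ∀ (v vbar : HeightOneSpectrum (𝓞 K)),
        ((2 : ℕ) : 𝓞 K) ∈ v.asIdeal → ((2 : ℕ) : 𝓞 K) ∈ vbar.asIdeal → vbar ≠ v →
      ∀ (π : (W.baseChange K).endRing), (π : AddMonoid.End (W.baseChange K).geomPoints) * π = π - 2 →
      ∀ (r : ℤ_[2]), r * r = r - 2 →
        (∀ τ ∈ GreenbergSelmer.inertia v, ∀ x : ↥((W.baseChange K).endEigenPrimaryTorsion 2 π r), τ • x = x ∨ τ • x = -x) →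
      ∀ (κ' : ZpExtension K 2), κ'.IsUnramifiedOutside vbar → ∀ (γ' : absoluteGaloisGroup K), κ'.IsTopGenerator γ' →
      Finite (endInvariants (conjRestricted κ' ↥((W.baseChange K).endEigenPrimaryTorsion 2 π r) vbar γ' - 1)) →
      ∀ (T : Finset (HeightOneSpectrum (𝓞 K))),
        (∀ w : HeightOneSpectrum (𝓞 K), w ∈ T ↔ ((2 : ℕ) : 𝓞 K) ∉ w.asIdeal ∧ ((7 * d : ℤ) : 𝓞 K) ∈ w.asIdeal) →
        (padicValNat 2 ((((restrictedSelmerBase ↥((W.baseChange K).endEigenPrimaryTorsion 2 π r) 2 vbar).map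
            (resOfLe ↥((W.baseChange K).endEigenPrimaryTorsion 2 π r) (le_top : κ'.kerSubgroup ≤ ⊤))).addSubgroupOf
            (restrictedSelmerZp κ' ↥((W.baseChange K).endEigenPrimaryTorsion 2 π r) vbar)).relIndex
          (endInvariants (conjRestricted κ' ↥((W.baseChange K).endEigenPrimaryTorsion 2 π r) vbar γ' - 1))) : ℤ) =
        (∑ w ∈ T, padicValNat 2 (Nat.card (resOfLe ↥((W.baseChange K).endEigenPrimaryTorsion 2 π r) (inf_le_inf_right (decomp w) (le_top : κ'.kerSubgroup ≤ ⊤))).ker) : ℕ) +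
          padicValNat 2 (Nat.card (resOfLe ↥((W.baseChange K).endEigenPrimaryTorsion 2 π r) (inf_le_inf_right (decomp vbar) (le_top : κ'.kerSubgroup ≤ ⊤))).ker) +
          es (d % 2) ((d / (2 - d % 2)) % 8) := by
  refine ⟨fun _ _ ↦ -1, ?_⟩
  intro d hd0 hsq hd4 W _ _ C hC _ K _ _ hK v vbar hv hvbar hne π hrel r hr _ κ' hκ' γ' hγ' hfinI T hT
  haveI := hfinI
  have hfinB := finite_restrictedSelmerBase_of_frame_of_finite_endInvariants hd0 W C hC hK hv hvbar hne π hrel hr κ' hκ' γ'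
  exact padicValNat_relIndex_control_of_frame_of_locSurj hd0 hsq W C hC hK hv hvbar hne π hrel hr κ' hκ' hγ' T hT
    (hLSfin d hd0 hsq hd4 W C hC K hK v vbar hv hvbar hne π hrel r hr hfinB)

end Frame

end Summit.BirchSwinnertonDyer.BirchSwinnertonDyer.Theorems.PrintCf2.RestrictedSelmerPair

end
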